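import Mathlib
import Summits.CriticalPhenomena.PercolationContinuityZ3.Theorems.PercNearOneGluingNoHeavyLowerTailGameCount

/-!
# Tree bijections: K♯ from a decision-tree embedding of the debtor family into the resolved family (hp-7 gen 84)

Helper file for crux `stmt-CriticalPhenomena-4575` (`NoHeavyLowerTail`, route `PercNearOneGluingNoHeavy`), hull-port seat
`prim-hp-7` (generation 84); `--supports stmt-CriticalPhenomena-4575`.  Pure finite set theory; everything is PROVED.
Memo: `run/shared/lean/prim/prim-hp-7/FROM-prim-hp-7-g84-TREE-BIJECTION.md`.

**Tree embeddings.**  For a coordinate `r` a family `X` of finite sets has the two *fibres* `fib0 X r = {S ∈ X : r ∉ S}` and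
`fib1 X r = {S.erase r : S ∈ X, r ∈ S}`, and `#X = #(fib0 X r) + #(fib1 X r)` (`card_eq_card_fib0_add_card_fib1`).  `TreeEmb X Y`
(inductive) holds if `X ⊆ Y`, or if for SOME coordinate `r` the two fibres of `X` tree-embed into the two fibres of `Y` — either
*straight* (`fib0 ↦ fib0`, `fib1 ↦ fib1`) or *crossed* (`fib0 ↦ fib1`, `fib1 ↦ fib0`).  A derivation is exactly an automorphism of an
(adaptive) binary decision tree of the cube — at every node one may swap the two subtrees — that maps `X` into `Y`; in particular it is an
explicit injection, so **`card_le_card_of_treeEmb : TreeEmb X Y → #X ≤ #Y`** (no hypothesis at all).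

**K♯ from tree embeddings.**  With `GeneratedDonors.kSharp_ineq_of_card_debtors_le_card_resolved` (gen 83): if the debtor family of a pair of
labellings tree-embeds into its resolved family, the K♯ inequality holds there (`kSharp_ineq_of_treeEmb`), and
**`kSharp_of_debtorTreeEmbedding`**: `[∀ monotone (g,h), TreeEmb (debtors g h) (resolved g h)] → KSharp 3`.
This is the gen-84 *tree-bijection conjecture* (memo §0): verified for all 30 046 920 monotone maps `2^[4] → 𝓗` (2 733 debtor/resolved
pairs), for all 1 439 'hard' census instances on `2^[5..7]`, and for ≈ 10⁶ annealed tight instances; it is incomparable with, and in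
practice finer than, the gen-83 game/section-tree domination (`GameCount.Dominates`, `GameCount.DomT`).
-/

namespace Summit.CriticalPhenomena.PercolationContinuityZ3.Theorems

namespace TreeBijection

open Finset

variable {α : Type*} [DecidableEq α]

/-- The `0`-fibre of a family at coordinate `r`: the members not containing `r`. -/
def fib0 (X : Finset (Finset α)) (r : α) : Finset (Finset α) := {S ∈ X | r ∉ S}

/-- The `1`-fibre of a family at coordinate `r`: the members containing `r`, with `r` erased. -/
def fib1 (X : Finset (Finset α)) (r : α) : Finset (Finset α) := ({S ∈ X | r ∈ S}).image (fun S => S.erase r)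

/-- Membership in the `0`-fibre. -/
theorem mem_fib0 {X : Finset (Finset α)} {r : α} {S : Finset α} : S ∈ fib0 X r ↔ S ∈ X ∧ r ∉ S := by
  unfold fib0; rw [mem_filter]

/-- Membership in the `1`-fibre: `S ∌ r` and `insert r S ∈ X`. -/
theorem mem_fib1 {X : Finset (Finset α)} {r : α} {S : Finset α} : S ∈ fib1 X r ↔ r ∉ S ∧ insert r S ∈ X := by
  unfold fib1
  rw [mem_image]
  constructor
  · rintro ⟨T, hT, rfl⟩
    rw [mem_filter] at hT
    exact ⟨notMem_erase r T, by rw [insert_erase hT.2]; exact hT.1⟩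
  · rintro ⟨hr, hS⟩
    exact ⟨insert r S, by rw [mem_filter]; exact ⟨hS, mem_insert_self r S⟩, erase_insert hr⟩

/-- **Fibre count**: a family splits into its two fibres at any coordinate. -/
theorem card_eq_card_fib0_add_card_fib1 (X : Finset (Finset α)) (r : α) : #X = #(fib0 X r) + #(fib1 X r) := by
  have h1 : #(fib1 X r) = #({S ∈ X | r ∈ S}) := by
    unfold fib1
    apply card_image_of_injOn
    intro S hS T hT hST
    rw [mem_coe, mem_filter] at hS hT
    have := congrArg (insert r) hST
    simp only [insert_erase hS.2, insert_erase hT.2] at this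
    exact this
  have h2 := card_filter_add_card_filter_not (s := X) (fun S => r ∈ S)
  rw [h1]
  unfold fib0
  omega

/-- **Tree embedding** of `X` into `Y`: `X ⊆ Y`, or some coordinate `r` splits both families into fibres that tree-embed *straight*
(`0 ↦ 0`, `1 ↦ 1`) or *crossed* (`0 ↦ 1`, `1 ↦ 0`).  A derivation is an automorphism of an adaptive binary decision tree of the cube
(subtree swaps allowed at every node) mapping `X` into `Y`. -/
inductive TreeEmb : Finset (Finset α) → Finset (Finset α) → Prop
  | leaf (X Y : Finset (Finset α)) (h : X ⊆ Y) : TreeEmb X Y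
  | straight (X Y : Finset (Finset α)) (r : α)
      (h₀ : TreeEmb (fib0 X r) (fib0 Y r)) (h₁ : TreeEmb (fib1 X r) (fib1 Y r)) : TreeEmb X Y
  | crossed (X Y : Finset (Finset α)) (r : α)
      (h₀ : TreeEmb (fib0 X r) (fib1 Y r)) (h₁ : TreeEmb (fib1 X r) (fib0 Y r)) : TreeEmb X Y

/-- **A tree embedding bounds the cardinality** (hp-7 gen 84): `TreeEmb X Y → #X ≤ #Y`.  (It is an explicit injection.) -/
theorem card_le_card_of_treeEmb {X Y : Finset (Finset α)} (h : TreeEmb X Y) : #X ≤ #Y := by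
  induction h with
  | leaf X Y h => exact card_le_card h
  | straight X Y r h₀ h₁ ih₀ ih₁ =>
    rw [card_eq_card_fib0_add_card_fib1 X r, card_eq_card_fib0_add_card_fib1 Y r]
    exact Nat.add_le_add ih₀ ih₁
  | crossed X Y r h₀ h₁ ih₀ ih₁ =>
    rw [card_eq_card_fib0_add_card_fib1 X r, card_eq_card_fib0_add_card_fib1 Y r, add_comm #(fib0 Y r)]
    exact Nat.add_le_add ih₀ ih₁

/-- Tree embedding is reflexive. -/
theorem treeEmb_refl (X : Finset (Finset α)) : TreeEmb X X := TreeEmb.leaf X X (subset_refl X)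

/-- The empty family tree-embeds into anything. -/
theorem treeEmb_empty (Y : Finset (Finset α)) : TreeEmb ∅ Y := TreeEmb.leaf ∅ Y (empty_subset Y)

/-- The `0`-fibre is monotone. -/
theorem fib0_mono {X Y : Finset (Finset α)} (h : X ⊆ Y) (r : α) : fib0 X r ⊆ fib0 Y r := by
  intro S hS; rw [mem_fib0] at hS ⊢; exact ⟨h hS.1, hS.2⟩

/-- The `1`-fibre is monotone. -/
theorem fib1_mono {X Y : Finset (Finset α)} (h : X ⊆ Y) (r : α) : fib1 X r ⊆ fib1 Y r := by
  intro S hS; rw [mem_fib1] at hS ⊢; exact ⟨hS.1, h hS.2⟩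

/-- A tree embedding can be precomposed with an inclusion. -/
theorem treeEmb_of_subset_of_treeEmb {X X' Y : Finset (Finset α)} (hX : X' ⊆ X) (h : TreeEmb X Y) : TreeEmb X' Y := by
  induction h generalizing X' with
  | leaf X Y h => exact TreeEmb.leaf X' Y (hX.trans h)
  | straight X Y r h₀ h₁ ih₀ ih₁ => exact TreeEmb.straight X' Y r (ih₀ (fib0_mono hX r)) (ih₁ (fib1_mono hX r))
  | crossed X Y r h₀ h₁ ih₀ ih₁ => exact TreeEmb.crossed X' Y r (ih₀ (fib0_mono hX r)) (ih₁ (fib1_mono hX r))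

/-- A tree embedding can be postcomposed with an inclusion. -/
theorem treeEmb_of_treeEmb_of_subset {X Y Y' : Finset (Finset α)} (h : TreeEmb X Y) (hY : Y ⊆ Y') : TreeEmb X Y' := by
  induction h generalizing Y' with
  | leaf X Y h => exact TreeEmb.leaf X Y' (h.trans hY)
  | straight X Y r h₀ h₁ ih₀ ih₁ => exact TreeEmb.straight X Y' r (ih₀ (fib0_mono hY r)) (ih₁ (fib1_mono hY r))
  | crossed X Y r h₀ h₁ ih₀ ih₁ => exact TreeEmb.crossed X Y' r (ih₀ (fib1_mono hY r)) (ih₁ (fib0_mono hY r))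

end TreeBijection

/-! ### K♯ from a tree embedding of the debtor family into the resolved family -/

namespace GeneratedDonors

open Finset OrientedAntipodalHall AntipodalStrongHarris AntipodalStrongHarris.Lab TreeBijection

variable {α : Type} [Fintype α] [DecidableEq α]

/-- **K♯ from a tree embedding** (hp-7 gen 84): if the debtor family of `(g, h)` tree-embeds into its resolved family, the K♯ inequality
`#charged ≤ #{q : q good ∨ qᶜ good}` holds at `(g, h)` (the embedding is an injection `debtors ↪ resolved`, and resolved sets are credited
and uncharged).  No monotonicity is needed for this step. -/
theorem kSharp_ineq_of_treeEmb (g h : Finset α → Lab 3) (hemb : TreeEmb (debtors g h) (resolved g h)) :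
    #{q ∈ (univ : Finset (Finset α)) | IsCharged 3 g h q} ≤
      #{q ∈ (univ : Finset (Finset α)) | (g q = top ∧ h (univ \ q) = bot) ∨ (g (univ \ q) = top ∧ h q = bot)} :=
  kSharp_ineq_of_card_debtors_le_card_resolved g h (card_le_card_of_treeEmb hemb)

/-- **Conjecture K♯ follows from the tree-bijection conjecture** (hp-7 gen 84): if for every pair of monotone labellings the debtor
family tree-embeds into the resolved family — i.e. some automorphism of an adaptive binary decision tree of the cube maps every debtor
set to a resolved set — then `KSharp 3` (hence Conjecture K, FS′, FS).  Verified for all monotone maps `2^[4] → 𝓗` and ≈ 10⁶ further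
instances on `2^[5..7]` (memo §0). -/
theorem kSharp_of_debtorTreeEmbedding
    (H : ∀ (α : Type) [Fintype α] [DecidableEq α] (g h : Finset α → Lab 3),
      (∀ ⦃X Y : Finset α⦄, X ⊆ Y → g X ≤ g Y) → (∀ ⦃X Y : Finset α⦄, X ⊆ Y → h X ≤ h Y) →
        TreeEmb (debtors g h) (resolved g h)) :
    KSharp 3 := by
  intro α _ _ g h hg hh
  exact kSharp_ineq_of_treeEmb g h (H α g h hg hh)

end GeneratedDonors

end Summit.CriticalPhenomena.PercolationContinuityZ3.Theorems

/-! ### Addendum (hp-7 gen 84, same session, after the 64-core census `kit84a` j308561): the GLOBAL tree-bijection conjecture is FALSE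

`TreeEmb (debtors g h) (resolved g h)` holds for every monotone map on `2^[4]` (all 30 046 920), for all 1 439 'hard' census instances on
`2^[5..7]`, for 2.2·10⁶ random maps on `2^[5..9]` and for 16 305 tight annealed maps on `2^[8]` — but it FAILS for rare tight non-pure maps
from `n = 6` on: the monotone map generated by `{000110 ↦ v₅, 001000 ↦ v₀, 001001 ↦ e₀₁, 010000 ↦ v₄, 010001 ↦ e₃₄, 100011 ↦ v₁, 100101 ↦ v₃}`
has `#debtors = #resolved = 20`, NO tree embedding (a count obstruction one level below every root), yet the gen-83 certificates exist
(`GameCount.DomT` holds and 168 of the 720 orders dominate).  Hence the hypothesis of `kSharp_of_debtorTreeEmbedding` (and of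
`kSharp_of_debtorOrderEmbedding` in `…LowerTailOrderEmbedding`) is false in general: these remain valid only as INSTANCE-level certificates
(`kSharp_ineq_of_treeEmb`), and the structural theorem `TreeBijection.dominates_reverse_of_orderEmb` shows that game domination (gen 83) is a
strictly more powerful certificate than any causal/tree bijection.  Memo `run/shared/lean/prim/prim-hp-7/FROM-prim-hp-7-g84-TREE-BIJECTION.md`
§0 (B); counterexample file `…/code/gen84/cex_tb_n6.json` (verified with three independent implementations). -/
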